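import Summits.Schanuel.Schanuel.Theorems.RootDecomp1KHyper42

/-!
# RootDecomp1KHyper — lens 6, generation 15 ADDENDUM 4 «UNIFORM n-PARAMETRIC ANCHORED THEOREM» (MeasuredAnchors.lean d7ef80c6…, 1059 l) — continuation (RootDecomp1KHyper43): §B the ENGINE `no_int_relation_of_mvWeakMeasure_hyperPoly` (kernel, `maxHeartbeats 1600000` as in the source) and `algebraicIndependent_option_of_mvWeakMeasure_hyperPoly`

(lens-6 g15 ADDENDUM 4 `MeasuredAnchors.lean`, sha256 d7ef80c6…6d97, own farm rc 0 · 0 sorry · axioms std; critic VERDICT STATUS L1634 (K-R18 MET; PORT GO (e)),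
CENSUS-REQUEST L1629; port by census-1 gen 15 in five parts RootDecomp1KHyper42–46; statements and proofs verbatim, one-line docstrings added,
generic one-liners / twins of landed lemmas made `private` with per-part private copies; `--supports stmt-Schanuel-33363`, no census credit.
Nothing here proves Schanuel; rung 0.)
-/

open Complex IntermediateField Polynomial

namespace Summit.Schanuel.Schanuel.Theorems.RootDecomp1KHyper

variable {n : ℕ}

namespace HyperCell

/-- `exp(−x) ≤ 1/x` for `x > 0`. -/
private theorem exp_neg_le_one_div'' {x : ℝ} (hx : 0 < x) : Real.exp (-x) ≤ 1 / x := by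
  rw [Real.exp_neg, ← one_div]
  exact one_div_le_one_div_of_le hx (by linarith [Real.add_one_le_exp x])

/-- Near a complex point `y`, a nonzero complex polynomial has no root other than (possibly) `y`. -/
private theorem exists_ball_eval_ne_zeroC' (μ : ℂ[X]) (hμ : μ ≠ 0) (y : ℂ) :
    ∃ δ : ℝ, 0 < δ ∧ ∀ w : ℂ, w ≠ y → ‖w - y‖ < δ → μ.eval w ≠ 0 := by
  have hfin : {x : ℂ | μ.IsRoot x}.Finite := Polynomial.finite_setOf_isRoot hμ
  set T : Set ℂ := {x : ℂ | μ.IsRoot x} \ {y} with hT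
  have hTfin : T.Finite := hfin.sdiff
  have hopen : Tᶜ ∈ nhds y := hTfin.isClosed.isOpen_compl.mem_nhds fun h => h.2 rfl
  obtain ⟨δ, hδ, hball⟩ := Metric.mem_nhds_iff.mp hopen
  refine ⟨δ, hδ, fun w hw hwδ hroot => ?_⟩
  have hwT : w ∈ T := ⟨hroot, hw⟩
  have hwb : w ∈ Metric.ball y δ := by rw [Metric.mem_ball, dist_eq_norm]; exact hwδ
  exact hball hwb hwT

/-- Lipschitz bound at a complex root: `‖μ(w)‖ ≤ M ‖w − y‖` for `‖w − y‖ ≤ 1`. -/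
private theorem exists_lipschitz_at_rootC' (μ : ℂ[X]) (y : ℂ) (hroot : μ.eval y = 0) :
    ∃ M : ℝ, 0 < M ∧ ∀ w : ℂ, ‖w - y‖ ≤ 1 → ‖μ.eval w‖ ≤ M * ‖w - y‖ := by
  set ν := μ /ₘ (X - C y) with hν
  have hdvd : (X - C y) * ν = μ := Polynomial.mul_divByMonic_eq_iff_isRoot.mpr hroot
  obtain ⟨M₀, hM₀⟩ := (isCompact_closedBall y 1).exists_bound_of_continuousOn
    (Polynomial.continuous ν).continuousOn
  refine ⟨max M₀ 0 + 1, by positivity, fun w hw => ?_⟩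
  have hmem : w ∈ Metric.closedBall y 1 := by rw [Metric.mem_closedBall, dist_eq_norm]; exact hw
  have h1 : μ.eval w = (w - y) * ν.eval w := by
    conv_lhs => rw [← hdvd]
    rw [eval_mul, eval_sub, eval_X, eval_C]
  rw [h1, norm_mul]
  calc ‖w - y‖ * ‖ν.eval w‖ ≤ ‖w - y‖ * M₀ := by gcongr; exact hM₀ _ hmem
    _ ≤ ‖w - y‖ * (max M₀ 0 + 1) := by gcongr; linarith [le_max_left M₀ 0]
    _ = (max M₀ 0 + 1) * ‖w - y‖ := mul_comm _ _

set_option maxHeartbeats 1600000 in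
/-- **Hyper-polynomial-approximation engine (kernel).**  No relation `Σ_{k ≤ K} G_k(θ) y^k = 0`,
`G_k ∈ ℤ[x]` not all zero, between a weakly measured `θ` and a `y` with `HyperPolyApprox θ d y`: the
homogenised specialisation `H = Σ_k G_k · P^k · E^{K−k}` at an approximant `P(θ)/E` close to the root `y`
of `μ = Σ G_k(θ) Y^k` has `H(θ) = E^K μ(P(θ)/E) ≠ 0`, degree `≤ K d + max deg G_k`, length
`≤ (Σ mvlen G_k)(1 + E + mvlen P)^K` (sub-multiplicativity, §A) — against the measure. -/
theorem no_int_relation_of_mvWeakMeasure_hyperPoly {θ : Fin n → ℂ}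
    (hθ : MvWeakMeasure θ) {d : ℕ} {y : ℂ} (hy : HyperPolyApprox θ d y) {K : ℕ}
    (G : Fin (K + 1) → MvPolynomial (Fin n) ℤ) (hG : ∃ k, G k ≠ 0)
    (hrel : ∑ k : Fin (K + 1), MvPolynomial.aeval θ (G k) * y ^ (k : ℕ) = 0) : False := by
  -- the complex polynomial μ(Y) = Σ_k G_k(θ) Y^k
  set μ : ℂ[X] := ∑ k : Fin (K + 1), C (MvPolynomial.aeval θ (G k)) * X ^ (k : ℕ) with hμdef
  have hμeval : ∀ w : ℂ, μ.eval w =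
      ∑ k : Fin (K + 1), MvPolynomial.aeval θ (G k) * w ^ (k : ℕ) := by
    intro w
    simp only [hμdef, eval_finsetSum, eval_mul, eval_C, eval_pow, eval_X]
  have hμcoeff : ∀ k : Fin (K + 1), μ.coeff k = MvPolynomial.aeval θ (G k) := by
    intro k
    simp only [hμdef, finsetSum_coeff, coeff_C_mul, coeff_X_pow]
    rw [Finset.sum_eq_single k]
    · simp
    · intro j _ hjk
      have : (k : ℕ) ≠ (j : ℕ) := fun h => hjk (Fin.ext h).symm
      simp [this]
    · intro h; exact absurd (Finset.mem_univ k) h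
  have hμ0 : μ ≠ 0 := by
    obtain ⟨k, hk⟩ := hG
    intro h0
    have h1 : μ.coeff k = 0 := by rw [h0, coeff_zero]
    rw [hμcoeff] at h1
    exact mvaeval_ne_zero_of_mvWeakMeasure hθ hk h1
  have hroot : μ.eval y = 0 := by rw [hμeval]; exact hrel
  obtain ⟨δ, hδ, hδroot⟩ := exists_ball_eval_ne_zeroC' μ hμ0 y
  obtain ⟨L, hL, hLip⟩ := exists_lipschitz_at_rootC' μ y hroot
  -- degrees, the measure
  set Dg : ℕ := Finset.univ.sup fun k : Fin (K + 1) => (G k).totalDegree with hDgdef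
  have hDg : ∀ k, (G k).totalDegree ≤ Dg := fun k =>
    Finset.le_sup (f := fun k : Fin (K + 1) => (G k).totalDegree) (Finset.mem_univ k)
  set Dt : ℕ := K * d + Dg with hDtdef
  obtain ⟨Cm, kk, hCm, hmeas⟩ := hθ Dt
  set Λ : ℤ := ∑ k, mvlen (G k) with hΛdef
  have hΛ : 0 ≤ Λ := Finset.sum_nonneg fun _ _ => mvlen_nonneg _
  have hΛR : (0 : ℝ) ≤ ((Λ : ℤ) : ℝ) := by exact_mod_cast hΛ
  -- constants
  set c₁ : ℝ := Cm * ((Λ : ℤ) : ℝ) ^ kk with hc₁def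
  set c₂ : ℝ := L with hc₂def
  have hc₁ : 0 ≤ c₁ := by positivity
  have hc₂ : 0 ≤ c₂ := hL.le
  set e₁ : ℕ := K * kk with he₁
  set N : ℕ := ⌈c₁ + c₂ + δ⁻¹⌉₊ + 1 with hNdef
  set m : ℕ := e₁ + K + N with hmdef
  have hδinv : 0 < δ⁻¹ := inv_pos.mpr hδ
  have hNgt : c₁ + c₂ + δ⁻¹ < N := by
    have h1 : c₁ + c₂ + δ⁻¹ ≤ ⌈c₁ + c₂ + δ⁻¹⌉₊ := Nat.le_ceil _
    rw [hNdef]; push_cast; linarith only [h1]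
  have hN2 : (N : ℝ) ≤ (2 : ℝ) ^ N := by
    have h := (Nat.lt_two_pow_self (n := N)).le
    have h' : ((N : ℕ) : ℝ) ≤ ((2 ^ N : ℕ) : ℝ) := Nat.cast_le.mpr h
    simpa using h'
  -- the approximation
  obtain ⟨Pa, E, hE, hPad, hne, hlt⟩ := hy m
  have hE1 : (1 : ℝ) ≤ E := by exact_mod_cast hE
  have hEpos : (0 : ℝ) < E := by exact_mod_cast hE
  have hE0 : E ≠ 0 := by omega
  have hEC : (E : ℂ) ≠ 0 := by exact_mod_cast hE0
  have hlen0a : (0 : ℝ) ≤ ((mvlen Pa : ℤ) : ℝ) := by exact_mod_cast mvlen_nonneg Pa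
  set Xr : ℝ := 1 + (E : ℝ) + ((mvlen Pa : ℤ) : ℝ) with hXdef
  have hX2 : 2 ≤ Xr := by rw [hXdef]; linarith only [hE1, hlen0a]
  have hX1 : 1 ≤ Xr := by linarith only [hX2]
  have hX0 : 0 < Xr := by linarith only [hX2]
  have hEX : (E : ℝ) ≤ Xr := by rw [hXdef]; linarith only [hlen0a]
  have hLX : ((mvlen Pa : ℤ) : ℝ) ≤ Xr := by rw [hXdef]; linarith only [hEpos]
  set β : ℂ := MvPolynomial.aeval θ Pa / (E : ℂ) with hβdef
  set ε : ℝ := Real.exp (-(Xr ^ m)) with hεdef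
  have hε0 : 0 < ε := Real.exp_pos _
  have hXe : ∀ e : ℕ, 1 ≤ Xr ^ e := fun e => one_le_pow₀ hX1
  have hXm : Xr ^ m = Xr ^ N * Xr ^ e₁ * Xr ^ K := by rw [hmdef, pow_add, pow_add]; ring
  have hXN : (N : ℝ) ≤ Xr ^ N := hN2.trans (pow_le_pow_left₀ (by norm_num) hX2 N)
  have hXm_gt : δ⁻¹ < Xr ^ m := by
    have h1 : Xr ^ N ≤ Xr ^ m := by
      rw [hXm]
      calc Xr ^ N = Xr ^ N * 1 * 1 := by ring
        _ ≤ Xr ^ N * Xr ^ e₁ * Xr ^ K := by gcongr <;> exact hXe _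
    linarith only [h1, hXN, hNgt, hc₁, hc₂]
  have hεδ : ε < δ := by
    calc ε < Real.exp (-δ⁻¹) := Real.exp_lt_exp.mpr (by linarith only [hXm_gt])
      _ ≤ 1 / δ⁻¹ := exp_neg_le_one_div'' hδinv
      _ = δ := by rw [one_div, inv_inv]
  have hε1 : ε ≤ 1 := by
    rw [hεdef]; exact Real.exp_le_one_iff.mpr (by linarith only [hXe m])
  have hyβ : ‖β - y‖ < ε := by rw [norm_sub_rev]; exact hlt
  have hyβ1 : ‖β - y‖ ≤ 1 := by linarith only [hyβ, hε1]
  have hyβδ : ‖β - y‖ < δ := by linarith only [hyβ, hεδ]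
  have hβne : β ≠ y := fun h => hne h.symm
  -- (1) μ(β) ≠ 0 and the Lipschitz bound
  have hμβ : μ.eval β ≠ 0 := hδroot β hβne hyβδ
  have hμβle : ‖μ.eval β‖ ≤ L * ε :=
    (hLip β hyβ1).trans (mul_le_mul_of_nonneg_left hyβ.le hL.le)
  -- (2) the integer polynomial H (homogenised specialisation)
  set H : MvPolynomial (Fin n) ℤ :=
    ∑ k : Fin (K + 1), G k * Pa ^ (k : ℕ) * MvPolynomial.C ((E : ℤ) ^ (K - k)) with hHdef
  have hsplit : ∀ k : Fin (K + 1), (E : ℂ) ^ K = (E : ℂ) ^ (k : ℕ) * (E : ℂ) ^ (K - k) := by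
    intro k
    rw [← pow_add, Nat.add_sub_of_le (Nat.lt_succ_iff.mp k.2)]
  have hEinv : ∀ k : Fin (K + 1), (E : ℂ) ^ (k : ℕ) * ((E : ℂ) ^ (k : ℕ))⁻¹ = 1 := fun k =>
    mul_inv_cancel₀ (pow_ne_zero _ hEC)
  have hHe : MvPolynomial.aeval θ H = (E : ℂ) ^ K * μ.eval β := by
    rw [hHdef, map_sum, hμeval, Finset.mul_sum]
    refine Finset.sum_congr rfl fun k _ => ?_
    rw [map_mul, map_mul, map_pow, MvPolynomial.aeval_C, hβdef, div_pow, hsplit k, div_eq_mul_inv]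
    push_cast
    linear_combination (-((E : ℂ) ^ (K - k) * MvPolynomial.aeval θ (G k) *
      (MvPolynomial.aeval θ Pa) ^ (k : ℕ))) * hEinv k
  -- (3) H ≠ 0
  have hH0 : H ≠ 0 := by
    intro h0
    have h1 : (E : ℂ) ^ K * μ.eval β = 0 := by rw [← hHe, h0, map_zero]
    rcases mul_eq_zero.mp h1 with h | h
    · exact pow_ne_zero K hEC h
    · exact hμβ h
  -- (4) upper bound ‖H(θ)‖ ≤ c₂ X^K ε
  have hup : ‖MvPolynomial.aeval θ H‖ ≤ c₂ * Xr ^ K * ε := by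
    rw [hHe, norm_mul, norm_pow, Complex.norm_natCast]
    calc (E : ℝ) ^ K * ‖μ.eval β‖ ≤ Xr ^ K * (L * ε) := by gcongr
      _ = c₂ * Xr ^ K * ε := by rw [hc₂def]; ring
  -- (5) lower bound from the measure: degree and length of H
  have hdegH : H.totalDegree ≤ Dt := by
    rw [hHdef]
    refine MvPolynomial.totalDegree_finsetSum_le fun k _ => ?_
    have hk : (k : ℕ) ≤ K := Nat.lt_succ_iff.mp k.2
    calc (G k * Pa ^ (k : ℕ) * MvPolynomial.C ((E : ℤ) ^ (K - (k : ℕ)))).totalDegree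
        ≤ (G k * Pa ^ (k : ℕ)).totalDegree + (MvPolynomial.C ((E : ℤ) ^ (K - (k : ℕ))) :
            MvPolynomial (Fin n) ℤ).totalDegree := MvPolynomial.totalDegree_mul _ _
      _ ≤ ((G k).totalDegree + (Pa ^ (k : ℕ)).totalDegree) + 0 := by
          rw [MvPolynomial.totalDegree_C]; exact add_le_add (MvPolynomial.totalDegree_mul _ _) le_rfl
      _ ≤ (Dg + (k : ℕ) * d) + 0 :=
          add_le_add (add_le_add (hDg k)
            ((MvPolynomial.totalDegree_pow _ _).trans (Nat.mul_le_mul_left _ hPad))) le_rfl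
      _ ≤ Dt := by rw [hDtdef]; nlinarith [hk]
  have hlenH : ((mvlen H : ℤ) : ℝ) ≤ Xr ^ K * ((Λ : ℤ) : ℝ) := by
    have h1 : ((mvlen H : ℤ) : ℝ) ≤
        ((∑ k : Fin (K + 1), mvlen (G k) * mvlen Pa ^ (k : ℕ) * (E : ℤ) ^ (K - k) : ℤ) : ℝ) := by
      rw [hHdef]; exact_mod_cast mvlen_homogSubst_le G Pa E
    refine h1.trans ?_
    rw [hΛdef]
    push_cast
    rw [Finset.mul_sum]
    refine Finset.sum_le_sum fun k _ => ?_
    have hk : (k : ℕ) ≤ K := Nat.lt_succ_iff.mp k.2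
    have hG0 : (0 : ℝ) ≤ ((mvlen (G k) : ℤ) : ℝ) := by exact_mod_cast mvlen_nonneg _
    have h2 : ((mvlen Pa : ℤ) : ℝ) ^ (k : ℕ) * (E : ℝ) ^ (K - k) ≤ Xr ^ K := by
      calc ((mvlen Pa : ℤ) : ℝ) ^ (k : ℕ) * (E : ℝ) ^ (K - k)
          ≤ Xr ^ (k : ℕ) * Xr ^ (K - k) :=
            mul_le_mul (pow_le_pow_left₀ hlen0a hLX _) (pow_le_pow_left₀ hEpos.le hEX _)
              (by positivity) (by positivity)
        _ = Xr ^ K := by rw [← pow_add, Nat.add_sub_of_le hk]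
    calc ((mvlen (G k) : ℤ) : ℝ) * ((mvlen Pa : ℤ) : ℝ) ^ (k : ℕ) * (E : ℝ) ^ (K - k)
        = ((mvlen (G k) : ℤ) : ℝ) * (((mvlen Pa : ℤ) : ℝ) ^ (k : ℕ) * (E : ℝ) ^ (K - k)) := by ring
      _ ≤ ((mvlen (G k) : ℤ) : ℝ) * Xr ^ K := mul_le_mul_of_nonneg_left h2 hG0
      _ = Xr ^ K * ((mvlen (G k) : ℤ) : ℝ) := mul_comm _ _
  have hlen0 : (0 : ℝ) ≤ ((mvlen H : ℤ) : ℝ) := by exact_mod_cast mvlen_nonneg H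
  have hlow : Real.exp (-(Cm * ((mvlen H : ℤ) : ℝ) ^ kk)) ≤ ‖MvPolynomial.aeval θ H‖ :=
    hmeas H hH0 hdegH
  have hc₁X : Cm * ((mvlen H : ℤ) : ℝ) ^ kk ≤ c₁ * Xr ^ e₁ := by
    have h1 : ((mvlen H : ℤ) : ℝ) ^ kk ≤ (Xr ^ K * ((Λ : ℤ) : ℝ)) ^ kk :=
      pow_le_pow_left₀ hlen0 hlenH kk
    have h2 : (Xr ^ K * ((Λ : ℤ) : ℝ)) ^ kk = ((Λ : ℤ) : ℝ) ^ kk * Xr ^ e₁ := by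
      rw [he₁, pow_mul Xr K kk, mul_pow]; ring
    calc Cm * ((mvlen H : ℤ) : ℝ) ^ kk ≤ Cm * (Xr ^ K * ((Λ : ℤ) : ℝ)) ^ kk :=
          mul_le_mul_of_nonneg_left h1 hCm.le
      _ = c₁ * Xr ^ e₁ := by rw [h2, hc₁def]; ring
  have hlow' : Real.exp (-(c₁ * Xr ^ e₁)) ≤ ‖MvPolynomial.aeval θ H‖ :=
    (Real.exp_le_exp.mpr (neg_le_neg hc₁X)).trans hlow
  -- (6) the clash
  have hchain : Real.exp (-(c₁ * Xr ^ e₁)) ≤ c₂ * Xr ^ K * ε := hlow'.trans hup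
  have hmain : c₁ * Xr ^ e₁ + c₂ * Xr ^ K ≤ Xr ^ m := by
    rw [hXm]
    have h1 : c₁ * Xr ^ e₁ ≤ c₁ * (Xr ^ e₁ * Xr ^ K) := by
      apply mul_le_mul_of_nonneg_left _ hc₁
      calc Xr ^ e₁ = Xr ^ e₁ * 1 := (mul_one _).symm
        _ ≤ Xr ^ e₁ * Xr ^ K := by gcongr; exact hXe _
    have h2 : c₂ * Xr ^ K ≤ c₂ * (Xr ^ e₁ * Xr ^ K) := by
      apply mul_le_mul_of_nonneg_left _ hc₂
      calc Xr ^ K = 1 * Xr ^ K := (one_mul _).symm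
        _ ≤ Xr ^ e₁ * Xr ^ K := by gcongr; exact hXe _
    have h3 : c₁ + c₂ ≤ Xr ^ N := by linarith only [hNgt, hXN, hδinv]
    calc c₁ * Xr ^ e₁ + c₂ * Xr ^ K
        ≤ c₁ * (Xr ^ e₁ * Xr ^ K) + c₂ * (Xr ^ e₁ * Xr ^ K) := add_le_add h1 h2
      _ = (c₁ + c₂) * (Xr ^ e₁ * Xr ^ K) := by ring
      _ ≤ Xr ^ N * (Xr ^ e₁ * Xr ^ K) := mul_le_mul_of_nonneg_right h3 (by positivity)
      _ = Xr ^ N * Xr ^ e₁ * Xr ^ K := by ring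
  have hlt2 : c₂ * Xr ^ K * ε < Real.exp (-(c₁ * Xr ^ e₁)) := by
    have h1 : c₂ * Xr ^ K < Real.exp (Xr ^ m - c₁ * Xr ^ e₁) := by
      have h2 := Real.add_one_le_exp (Xr ^ m - c₁ * Xr ^ e₁)
      linarith only [h2, hmain]
    have h3 : Real.exp (Xr ^ m - c₁ * Xr ^ e₁) * ε = Real.exp (-(c₁ * Xr ^ e₁)) := by
      rw [hεdef, ← Real.exp_add]; congr 1; ring
    calc c₂ * Xr ^ K * ε < Real.exp (Xr ^ m - c₁ * Xr ^ e₁) * ε :=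
          mul_lt_mul_of_pos_right h1 hε0
      _ = Real.exp (-(c₁ * Xr ^ e₁)) := h3
  exact absurd hchain (not_le.mpr hlt2)

/-- **Weak class principle, polynomial-approximation version (kernel).**  `MvWeakMeasure θ` and
`HyperPolyApprox θ d y` make `(y, θ₁, …, θₙ)` algebraically independent. -/
theorem algebraicIndependent_option_of_mvWeakMeasure_hyperPoly {θ : Fin n → ℂ}
    (hθ : MvWeakMeasure θ) {d : ℕ} {y : ℂ} (hy : HyperPolyApprox θ d y) :
    AlgebraicIndependent ℚ (fun o : Option (Fin n) => o.elim y θ) := by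
  have hθi := algebraicIndependent_of_mvWeakMeasure hθ
  rw [hθi.option_iff_transcendental]
  intro halg
  obtain ⟨K, G, hGK, hrel⟩ := exists_int_mvrelation halg
  exact no_int_relation_of_mvWeakMeasure_hyperPoly hθ hy G ⟨Fin.last K, hGK⟩ hrel

end HyperCell

end Summit.Schanuel.Schanuel.Theorems.RootDecomp1KHyper
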